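import Mathlib
import HarnessLib
import Summits.ResolutionOfSingularities.ResolutionOfSingularities.Theorems.RadicialJungCleanModelsLens5GradedBasis

/-!
# Route `RadicialJung`, crux `CleanModels` (stmt-15917) — lens 5, THEOREM T step (V): immediate values (core)

Port of `Cruxes/DescentPerfectToAll/Lens5_ImmediateValues.lean` (res-B-lens-5 g9 support workfile), Part 1.
OURS · counted 0. Nothing here proves resolution in characteristic `p`.

This file contains:
* Section `SpanPowers`: the `K^p`-line `V(g_0)` is a subfield, membership lemmas
-/

noncomputable section

set_option linter.dupNamespace false

open Module
open Summit.ResolutionOfSingularities.ResolutionOfSingularities.Theorems.RadicialJung.CleanModels.Lens5.GradedBasis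

namespace Summit.ResolutionOfSingularities.ResolutionOfSingularities.Theorems.RadicialJung.CleanModels.Lens5.ImmediateValues

variable {K : Type} [Field K] {Γ₀ : Type} [LinearOrderedCommGroupWithZero Γ₀]

section SpanPowers

/-! ### The `K^p`-line `V(g₀) := span_{K^p} {g₀^j : j < p}` (`K^p = (frobenius K p).fieldRange`) is the subfield `K^p(g₀)` -/

variable {p : ℕ} [hp : Fact p.Prime] [CharP K p]

/-- A `p`-th power in `K` lies in the Frobenius image `K^p`. [folklore] -/
theorem pow_mem_fieldRange_frobenius (x : K) : x ^ p ∈ (frobenius K p).fieldRange :=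
  RingHom.mem_fieldRange.mpr ⟨x, frobenius_def p x⟩

/-- Elements of `K^p` are `p`-th powers. [folklore] -/
theorem exists_pow_eq_of_mem_fieldRange_frobenius {a : K} (ha : a ∈ (frobenius K p).fieldRange) : ∃ α : K, α ^ p = a := by
  obtain ⟨α, hα⟩ := RingHom.mem_fieldRange.mp ha
  exact ⟨α, by rw [← hα, frobenius_def]⟩

/-- `1` lies in the `K^p`-span of powers of `g₀`. [folklore] -/
theorem one_mem_span_powers (g₀ : K) :
    (1 : K) ∈ Submodule.span (frobenius K p).fieldRange (Set.range fun j : Fin p => g₀ ^ (j : ℕ)) :=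
  Submodule.subset_span ⟨⟨0, hp.out.pos⟩, pow_zero g₀⟩

/-- `g₀` lies in the `K^p`-span of its own powers. [folklore] -/
theorem self_mem_span_powers (g₀ : K) :
    g₀ ∈ Submodule.span (frobenius K p).fieldRange (Set.range fun j : Fin p => g₀ ^ (j : ℕ)) :=
  Submodule.subset_span ⟨⟨1, hp.out.one_lt⟩, pow_one g₀⟩

/-- `dim_{K^p} V(g₀) ≤ p`. [folklore] -/
theorem finrank_span_powers_le (g₀ : K) :
    finrank (frobenius K p).fieldRange (Submodule.span (frobenius K p).fieldRange (Set.range fun j : Fin p => g₀ ^ (j : ℕ))) ≤ p := by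
  have h := finrank_range_le_card (R := (frobenius K p).fieldRange) (fun j : Fin p => g₀ ^ (j : ℕ))
  simpa [Set.finrank] using h

/-- `V(g₀)` is stable under multiplication by `g₀` (because `g₀^p ∈ K^p`). [folklore] -/
theorem self_mul_mem_span_powers (g₀ : K) {x : K}
    (hx : x ∈ Submodule.span (frobenius K p).fieldRange (Set.range fun j : Fin p => g₀ ^ (j : ℕ))) :
    g₀ * x ∈ Submodule.span (frobenius K p).fieldRange (Set.range fun j : Fin p => g₀ ^ (j : ℕ)) := by
  set V := Submodule.span (frobenius K p).fieldRange (Set.range fun j : Fin p => g₀ ^ (j : ℕ)) with hV_def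
  refine Submodule.span_induction (p := fun x _ => g₀ * x ∈ V) ?_ ?_ ?_ ?_ hx
  · rintro x ⟨j, rfl⟩
    by_cases hj : (j : ℕ) + 1 < p
    · exact Submodule.subset_span ⟨⟨(j : ℕ) + 1, hj⟩, by simp [pow_succ, mul_comm]⟩
    · have hjp : (j : ℕ) + 1 = p := by omega
      have hgp : g₀ * g₀ ^ (j : ℕ) = g₀ ^ p := by rw [← pow_succ', hjp]
      rw [hgp]
      have : g₀ ^ p = (⟨g₀ ^ p, pow_mem_fieldRange_frobenius g₀⟩ : (frobenius K p).fieldRange) • (1 : K) := by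
        rw [Subfield.smul_def, smul_eq_mul, mul_one]
      rw [this]
      exact V.smul_mem _ (one_mem_span_powers g₀)
  · simp
  · intro x y _ _ hx hy
    rw [mul_add]
    exact V.add_mem hx hy
  · intro a x _ hx
    rw [Subfield.smul_def, smul_eq_mul, mul_left_comm]
    have : (a : K) * (g₀ * x) = a • (g₀ * x) := by rw [Subfield.smul_def, smul_eq_mul]
    rw [this]
    exact V.smul_mem a hx

/-- `V(g₀)` is closed under multiplication. [folklore] -/
theorem mul_mem_span_powers (g₀ : K) {x y : K}
    (hx : x ∈ Submodule.span (frobenius K p).fieldRange (Set.range fun j : Fin p => g₀ ^ (j : ℕ)))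
    (hy : y ∈ Submodule.span (frobenius K p).fieldRange (Set.range fun j : Fin p => g₀ ^ (j : ℕ))) :
    x * y ∈ Submodule.span (frobenius K p).fieldRange (Set.range fun j : Fin p => g₀ ^ (j : ℕ)) := by
  set V := Submodule.span (frobenius K p).fieldRange (Set.range fun j : Fin p => g₀ ^ (j : ℕ)) with hV_def
  have hpow : ∀ n : ℕ, ∀ z ∈ V, g₀ ^ n * z ∈ V := by
    intro n
    induction n with
    | zero => intro z hz; simpa using hz
    | succ n ih => intro z hz; rw [pow_succ, mul_assoc]; exact ih _ (self_mul_mem_span_powers g₀ hz)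
  obtain ⟨a, rfl⟩ := (Submodule.mem_span_range_iff_exists_fun _).mp hx
  rw [Finset.sum_mul]
  refine V.sum_mem fun j _ => ?_
  have : (a j • g₀ ^ (j : ℕ)) * y = a j • (g₀ ^ (j : ℕ) * y) := by
    rw [Subfield.smul_def, Subfield.smul_def, smul_eq_mul, smul_eq_mul, mul_assoc]
  rw [this]
  exact V.smul_mem _ (hpow j y hy)

/-- `V(g₀)` is closed under inverses (injective `K^p`-linear endo of finite-dim `V(g₀)` is surjective). [folklore] -/
theorem inv_mem_span_powers (g₀ : K) {x : K}
    (hx : x ∈ Submodule.span (frobenius K p).fieldRange (Set.range fun j : Fin p => g₀ ^ (j : ℕ))) :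
    x⁻¹ ∈ Submodule.span (frobenius K p).fieldRange (Set.range fun j : Fin p => g₀ ^ (j : ℕ)) := by
  set V := Submodule.span (frobenius K p).fieldRange (Set.range fun j : Fin p => g₀ ^ (j : ℕ)) with hV_def
  by_cases hx0 : x = 0
  · rw [hx0, inv_zero]; exact V.zero_mem
  haveI : Module.Finite (frobenius K p).fieldRange V := Module.Finite.span_of_finite _ (Set.finite_range _)
  let f : V →ₗ[(frobenius K p).fieldRange] V :=
    { toFun := fun y => ⟨x * y, mul_mem_span_powers g₀ hx y.2⟩
      map_add' := fun y y' => by ext; simp [mul_add]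
      map_smul' := fun a y => by ext; simp only [Submodule.coe_smul_of_tower, RingHom.id_apply, Subfield.smul_def, smul_eq_mul]; ring }
  have hinj : Function.Injective f := by
    intro y y' h
    have h' : x * (y : K) = x * (y' : K) := congrArg Subtype.val h
    exact Subtype.ext (mul_left_cancel₀ hx0 h')
  obtain ⟨y, hy⟩ := (LinearMap.injective_iff_surjective.mp hinj) ⟨1, one_mem_span_powers g₀⟩
  have hxy : x * (y : K) = 1 := congrArg Subtype.val hy
  rw [inv_eq_of_mul_eq_one_right hxy]
  exact y.2

/-- Membership in `V(g₀)` in the currency of the stub: `x = ∑_{j<p} c_j^p g₀^j`. [folklore] -/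
theorem mem_span_powers_iff (g₀ x : K) :
    x ∈ Submodule.span (frobenius K p).fieldRange (Set.range fun j : Fin p => g₀ ^ (j : ℕ)) ↔
      ∃ c : Fin p → K, ∑ j, c j ^ p * g₀ ^ (j : ℕ) = x := by
  rw [Submodule.mem_span_range_iff_exists_fun]
  constructor
  · rintro ⟨a, rfl⟩
    choose α hα using fun j => exists_pow_eq_of_mem_fieldRange_frobenius (a j).2
    exact ⟨α, Finset.sum_congr rfl fun j _ => by rw [hα, Subfield.smul_def, smul_eq_mul]⟩
  · rintro ⟨c, rfl⟩
    exact ⟨fun j => ⟨c j ^ p, pow_mem_fieldRange_frobenius (c j)⟩,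
      Finset.sum_congr rfl fun j _ => by rw [Subfield.smul_def, smul_eq_mul]⟩

/-- **`K^p(g₀)` as a subfield, def-free.** There is a subfield `M` of `K` whose elements are exactly the
sums `∑_{j<p} c_j^p g₀^j` (no hypothesis on `g₀`; if `g₀ ∈ K^p` this is `K^p`). [folklore] -/
theorem exists_subfield_pthPowers_adjoin (g₀ : K) :
    ∃ M : Subfield K, ∀ x : K, x ∈ M ↔ ∃ c : Fin p → K, ∑ j, c j ^ p * g₀ ^ (j : ℕ) = x := by
  set V := Submodule.span (frobenius K p).fieldRange (Set.range fun j : Fin p => g₀ ^ (j : ℕ)) with hV_def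
  refine ⟨Subfield.closure (V : Set K), fun x => ?_⟩
  rw [← mem_span_powers_iff]
  constructor
  · intro hx
    refine Subfield.closure_induction (p := fun x _ => x ∈ V) (fun x hx => hx) (one_mem_span_powers g₀)
      (fun x y _ _ hx hy => V.add_mem hx hy) (fun x _ hx => V.neg_mem hx) (fun x _ hx => inv_mem_span_powers g₀ hx)
      (fun x y _ _ hx hy => mul_mem_span_powers g₀ hx hy) hx
  · exact fun hx => Subfield.subset_closure hx

end SpanPowers

end Summit.ResolutionOfSingularities.ResolutionOfSingularities.Theorems.RadicialJung.CleanModels.Lens5.ImmediateValues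

end
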